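import Summits.BirchSwinnertonDyer.Rank1Residual.X11b.Three.ImageAtThree
import HarnessLib

/-!
# X11b at `p = 3` (cell `bsd-stepL`, seat `bsd-stepL-koly`): the NORMAL subgroups of `GL₂(𝔽₃)` —
# a proper normal subgroup lies in `SL₂(𝔽₃)` (the `𝔽₃` substitute for Artin's theorem)

HONEST FRAMING (cell `bsd-stepL`, FULL-BSD rank ≤ 1 programme D-0033 tranche 1a; memo
`run/shared/lean/pub/bsd-stepL/koly/MEMO-v2.md` §1 Lemma B (B4)): finite, elementary THEOREMS about
`GL₂(𝔽₃)`; no named fact, no `sorry`, certificates by plain `decide` over the tree's computational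
model `GL2F3.M2` (`Three/ImageAtThree.lean`); nothing about elliptic curves is asserted; nothing is
booked.

## What is proved and why

Artin's theorem "a normal subgroup of `GL₂(F)` contains `SL₂(F)` or is central" needs an `a ∈ F`
with `a ≠ 0`, `a² ≠ 1` and FAILS for `F = 𝔽₃` (`Q₈ ⊲ GL₂(𝔽₃)`; see the tree's
`Literature/NumberTheory/GaloisRepresentations/NormalSubgroupsGL2.lean`, docstring of
`toGL_range_le_or_le_center_of_normal`). What survives at `3`, and what MEMO-v2 Lemma B (B4) uses,
is:

* `GL2F3.eq_top_of_normal_of_det_ne_one` — **a normal subgroup of `GL₂(𝔽₃)` containing an element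
  of determinant `≠ 1` is everything**;
* `GL2F3.le_ker_det_of_normal_of_ne_top` — equivalently, **every proper normal subgroup of
  `GL₂(𝔽₃)` lies in `SL₂(𝔽₃) = ker det`** (so the normal subgroups are `1, {±1}, Q₈, SL₂(𝔽₃)`,
  `GL₂(𝔽₃)` — the list itself is not needed and not proved).

Use (memo B4, prose there): for a ring-class field `K[n]` of the Heegner field `K` (`3 ∤ d_K n`),
the image `H` of `G_{K[n]}` under `ρ̄_{E,3}` (onto `GL₂(𝔽₃)` by `Surj(3)`) is normal since `K[n]/ℚ`
is Galois; if `H ≠ GL₂(𝔽₃)` then `H ≤ SL₂(𝔽₃)`, so `ℚ(E[3])^{SL₂} = ℚ(√−3) ⊆ K[n]`, impossible as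
`3` is unramified in `K[n]`; hence `H = GL₂(𝔽₃)` and `E[3]^{G_{K[n]}} = 0` — the input
"`A_m[𝔭_m](K[n]) = 0`" of the Kolyvagin derivative construction for `E` and every level-raised
`A_m` (SZ14 §4.2/§8.1) at `p = 3`.

Method: two `decide`d certificates over the `81` arrays of `GL2F3.M2` — (C1) for each of the `24`
arrays `g` of determinant `−1`, the transvections `T = (1 1; 0 1)` and `T′ = (1 0; 1 1)` are each a
product of TWO conjugates `x g x⁻¹ · y g y⁻¹` (table `conjTable`, exhaustive search); (C2) each of
the `24` arrays of determinant `1` is a word of length `≤ 5` in `T, T′` (table `wordTable`, breadth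
first search) — transported to `GL (Fin 2) (ZMod 3)` exactly as in `ImageAtThree.lean`, then
`ker det ≤ H`, `[GL₂(𝔽₃) : ker det] = 2` (`GL2F3.index_ker_det`) and `g ∉ ker det` give `H = ⊤`.

References: E. Artin, *Geometric Algebra*, Ch. IV Thm 4.9 (the exception `GL₂(𝔽₃)`); J.-P. Serre,
Invent. Math. 15 (1972) §2. Memo: `koly/MEMO-v2.md` §1 Lemma B (B4), referee PASS
`referee/VERDICT-KOLY-MEMO-v2-g5.md`.
-/

namespace Summit.BirchSwinnertonDyer.Rank1Residual.X11b.Three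

namespace GL2F3

open Matrix

namespace M2

/-- The identity array. [folklore] -/
def one : M2 := ⟨1, 0, 0, 1⟩

/-- The transvection `T = (1 1; 0 1)`. [folklore] -/
def tv : M2 := ⟨1, 1, 0, 1⟩

/-- The transvection `T′ = (1 0; 1 1)`. [folklore] -/
def tv' : M2 := ⟨1, 0, 1, 1⟩

/-- The inverse of an array of determinant `±1`: `det(x) · adj(x)` (for `d ∈ 𝔽₃ˣ`, `d⁻¹ = d`).
Junk for `det x = 0`. [folklore] -/
def inv (x : M2) : M2 := ⟨det x * x.d, -(det x * x.b), -(det x * x.c), det x * x.a⟩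

/-- The conjugate `x g x⁻¹` on arrays (with `inv` for `x⁻¹`). [folklore] -/
def conj (x g : M2) : M2 := mul (mul x g) (inv x)

/-- `x · inv x = 1` for `det x ≠ 0` — checked by `decide` over the `81` arrays. [folklore] -/
theorem mul_inv_certificate : ∀ x : M2, det x ≠ 0 → mul x (inv x) = one := by
  decide

/-- **Conjugation table** (exhaustive search): for each of the `24` arrays `g` of determinant
`−1 = 2`, two pairs `((x₁, x₂), (y₁, y₂))` of invertible arrays with
`x₁ g x₁⁻¹ · x₂ g x₂⁻¹ = T` and `y₁ g y₁⁻¹ · y₂ g y₂⁻¹ = T′`. Junk `((1,1),(1,1))` elsewhere.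
[folklore] -/
def conjTable (g : M2) : (M2 × M2) × (M2 × M2) :=
  if g = ⟨0, 1, 1, 0⟩ then ((⟨0, 1, 1, 1⟩, ⟨1, 2, 1, 1⟩), (⟨1, 1, 0, 1⟩, ⟨1, 1, 1, 2⟩)) else
  if g = ⟨0, 1, 1, 1⟩ then ((⟨0, 1, 1, 2⟩, ⟨0, 1, 2, 0⟩), (⟨0, 1, 2, 0⟩, ⟨0, 1, 2, 1⟩)) else
  if g = ⟨0, 1, 1, 2⟩ then ((⟨0, 1, 1, 0⟩, ⟨0, 1, 1, 2⟩), (⟨0, 1, 1, 0⟩, ⟨0, 1, 1, 1⟩)) else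
  if g = ⟨0, 2, 2, 0⟩ then ((⟨0, 1, 1, 1⟩, ⟨1, 2, 1, 1⟩), (⟨1, 1, 0, 1⟩, ⟨1, 1, 1, 2⟩)) else
  if g = ⟨0, 2, 2, 1⟩ then ((⟨0, 1, 1, 0⟩, ⟨0, 1, 1, 2⟩), (⟨0, 1, 1, 0⟩, ⟨0, 1, 1, 1⟩)) else
  if g = ⟨0, 2, 2, 2⟩ then ((⟨0, 1, 1, 2⟩, ⟨0, 1, 2, 0⟩), (⟨0, 1, 2, 0⟩, ⟨0, 1, 2, 1⟩)) else
  if g = ⟨1, 0, 0, 2⟩ then ((⟨0, 1, 1, 0⟩, ⟨1, 1, 1, 0⟩), (⟨0, 1, 1, 0⟩, ⟨0, 1, 1, 1⟩)) else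
  if g = ⟨1, 0, 1, 2⟩ then ((⟨0, 1, 1, 0⟩, ⟨1, 1, 1, 0⟩), (⟨1, 0, 0, 1⟩, ⟨1, 0, 1, 1⟩)) else
  if g = ⟨1, 0, 2, 2⟩ then ((⟨0, 1, 1, 0⟩, ⟨0, 1, 2, 0⟩), (⟨1, 0, 0, 1⟩, ⟨1, 0, 0, 2⟩)) else
  if g = ⟨1, 1, 0, 2⟩ then ((⟨0, 1, 1, 2⟩, ⟨1, 0, 1, 2⟩), (⟨0, 1, 1, 0⟩, ⟨0, 1, 1, 1⟩)) else
  if g = ⟨1, 1, 1, 0⟩ then ((⟨0, 1, 1, 1⟩, ⟨0, 1, 2, 1⟩), (⟨0, 1, 2, 0⟩, ⟨0, 1, 2, 1⟩)) else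
  if g = ⟨1, 1, 2, 1⟩ then ((⟨0, 1, 1, 0⟩, ⟨0, 1, 2, 2⟩), (⟨0, 1, 2, 0⟩, ⟨0, 1, 2, 1⟩)) else
  if g = ⟨1, 2, 0, 2⟩ then ((⟨0, 1, 1, 1⟩, ⟨1, 0, 1, 1⟩), (⟨0, 1, 1, 0⟩, ⟨0, 1, 1, 1⟩)) else
  if g = ⟨1, 2, 1, 1⟩ then ((⟨0, 1, 1, 1⟩, ⟨0, 1, 2, 0⟩), (⟨0, 1, 1, 0⟩, ⟨0, 1, 1, 1⟩)) else
  if g = ⟨1, 2, 2, 0⟩ then ((⟨0, 1, 1, 0⟩, ⟨0, 1, 2, 1⟩), (⟨0, 1, 1, 0⟩, ⟨0, 1, 1, 1⟩)) else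
  if g = ⟨2, 0, 0, 1⟩ then ((⟨0, 1, 1, 0⟩, ⟨1, 1, 1, 0⟩), (⟨0, 1, 1, 0⟩, ⟨0, 1, 1, 1⟩)) else
  if g = ⟨2, 0, 1, 1⟩ then ((⟨0, 1, 1, 0⟩, ⟨0, 1, 2, 0⟩), (⟨1, 0, 0, 1⟩, ⟨1, 0, 0, 2⟩)) else
  if g = ⟨2, 0, 2, 1⟩ then ((⟨0, 1, 1, 0⟩, ⟨1, 1, 1, 0⟩), (⟨1, 0, 0, 1⟩, ⟨1, 0, 1, 1⟩)) else
  if g = ⟨2, 1, 0, 1⟩ then ((⟨0, 1, 1, 1⟩, ⟨1, 0, 1, 1⟩), (⟨0, 1, 1, 0⟩, ⟨0, 1, 1, 1⟩)) else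
  if g = ⟨2, 1, 1, 0⟩ then ((⟨0, 1, 1, 0⟩, ⟨0, 1, 2, 1⟩), (⟨0, 1, 1, 0⟩, ⟨0, 1, 1, 1⟩)) else
  if g = ⟨2, 1, 2, 2⟩ then ((⟨0, 1, 1, 1⟩, ⟨0, 1, 2, 0⟩), (⟨0, 1, 1, 0⟩, ⟨0, 1, 1, 1⟩)) else
  if g = ⟨2, 2, 0, 1⟩ then ((⟨0, 1, 1, 2⟩, ⟨1, 0, 1, 2⟩), (⟨0, 1, 1, 0⟩, ⟨0, 1, 1, 1⟩)) else
  if g = ⟨2, 2, 1, 2⟩ then ((⟨0, 1, 1, 0⟩, ⟨0, 1, 2, 2⟩), (⟨0, 1, 2, 0⟩, ⟨0, 1, 2, 1⟩)) else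
  if g = ⟨2, 2, 2, 0⟩ then ((⟨0, 1, 1, 1⟩, ⟨0, 1, 2, 1⟩), (⟨0, 1, 2, 0⟩, ⟨0, 1, 2, 1⟩)) else
  ((one, one), (one, one))

/-- **Certificate (C1):** for every array `g` of determinant `2 = −1`, the four table entries are
invertible and `T`, `T′` are the displayed products of two conjugates of `g`. Checked by `decide`
over the `81` arrays. [folklore] -/
theorem conj_certificate : ∀ g : M2, det g = 2 →
    det (conjTable g).1.1 ≠ 0 ∧ det (conjTable g).1.2 ≠ 0 ∧
    det (conjTable g).2.1 ≠ 0 ∧ det (conjTable g).2.2 ≠ 0 ∧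
    mul (conj (conjTable g).1.1 g) (conj (conjTable g).1.2 g) = tv ∧
    mul (conj (conjTable g).2.1 g) (conj (conjTable g).2.2 g) = tv' := by
  decide

/-- Evaluation of a word in `T` (`true`) and `T′` (`false`): `[b₁, …, b_k] ↦ t_{b₁} ⋯ t_{b_k}`.
[folklore] -/
def evalWord : List Bool → M2
  | [] => one
  | b :: w => mul (if b then tv else tv') (evalWord w)

/-- **Word table** (breadth-first search): each of the `24` arrays of determinant `1` as a word of
length `≤ 5` in `T, T′` (positive words suffice, `T² = T⁻¹`). Junk `[]` elsewhere. [folklore] -/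
def wordTable (h : M2) : List Bool :=
  if h = ⟨0, 1, 2, 0⟩ then [true, false, false, true] else
  if h = ⟨0, 1, 2, 1⟩ then [true, false, false] else
  if h = ⟨0, 1, 2, 2⟩ then [false, true, false, false] else
  if h = ⟨0, 2, 1, 0⟩ then [false, true, true, false] else
  if h = ⟨0, 2, 1, 1⟩ then [true, true, false] else
  if h = ⟨0, 2, 1, 2⟩ then [true, true, false, true] else
  if h = ⟨1, 0, 1, 1⟩ then [false] else
  if h = ⟨1, 0, 2, 1⟩ then [false, false] else
  if h = ⟨1, 1, 0, 1⟩ then [true] else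
  if h = ⟨1, 1, 1, 2⟩ then [false, true] else
  if h = ⟨1, 1, 2, 0⟩ then [false, false, true] else
  if h = ⟨1, 2, 0, 1⟩ then [true, true] else
  if h = ⟨1, 2, 1, 0⟩ then [false, true, true] else
  if h = ⟨1, 2, 2, 2⟩ then [false, false, true, true] else
  if h = ⟨2, 0, 0, 2⟩ then [false, true, false, true] else
  if h = ⟨2, 0, 1, 2⟩ then [true, false, true] else
  if h = ⟨2, 0, 2, 2⟩ then [false, false, true, false, true] else
  if h = ⟨2, 1, 0, 2⟩ then [false, true, false] else
  if h = ⟨2, 1, 1, 1⟩ then [true, false] else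
  if h = ⟨2, 1, 2, 0⟩ then [false, false, true, false] else
  if h = ⟨2, 2, 0, 2⟩ then [false, true, false, true, true] else
  if h = ⟨2, 2, 1, 0⟩ then [true, false, true, true] else
  if h = ⟨2, 2, 2, 1⟩ then [true, true, false, false] else
  []

/-- **Certificate (C2):** every array of determinant `1` is the value of its table word. Checked by
`decide` over the `81` arrays. [folklore] -/
theorem word_certificate : ∀ h : M2, det h = 1 → evalWord (wordTable h) = h := by
  decide

/-- `toMat one = 1`. [folklore] -/
theorem toMat_one : toMat one = 1 := by
  simp only [toMat, one]
  ext i j; fin_cases i <;> fin_cases j <;> rfl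

end M2

/-! ### Transport to `GL (Fin 2) (ZMod 3)` -/

/-- The inverse in `GL₂(𝔽₃)` of `toGL x` is `toGL (inv x)`: its underlying matrix is
`M2.toMat (M2.inv x)`. [folklore] -/
theorem val_toGL_inv (x : M2) (hx : M2.det x ≠ 0) :
    (((toGL x hx)⁻¹ : GL (Fin 2) (ZMod 3)) : Matrix (Fin 2) (Fin 2) (ZMod 3)) =
      M2.toMat (M2.inv x) := by
  have h1 : M2.toMat x * M2.toMat (M2.inv x) = 1 := by
    rw [← M2.toMat_mul, M2.mul_inv_certificate x hx, M2.toMat_one]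
  have h2 : ((toGL x hx : GL (Fin 2) (ZMod 3)) : Matrix (Fin 2) (Fin 2) (ZMod 3)) *
      M2.toMat (M2.inv x) = 1 := by rw [val_toGL]; exact h1
  calc (((toGL x hx)⁻¹ : GL (Fin 2) (ZMod 3)) : Matrix (Fin 2) (Fin 2) (ZMod 3))
      = ((toGL x hx)⁻¹ : GL (Fin 2) (ZMod 3)) *
          (((toGL x hx : GL (Fin 2) (ZMod 3)) : Matrix (Fin 2) (Fin 2) (ZMod 3)) *
            M2.toMat (M2.inv x)) := by rw [h2, mul_one]
    _ = M2.toMat (M2.inv x) := by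
          rw [← mul_assoc, Units.inv_mul, one_mul]

/-- The underlying matrix of the conjugate `toGL x · g · (toGL x)⁻¹` is `M2.toMat (M2.conj x (ofMat g))`.
[folklore] -/
theorem val_conj_toGL (x : M2) (hx : M2.det x ≠ 0) (g : GL (Fin 2) (ZMod 3)) :
    ((toGL x hx * g * (toGL x hx)⁻¹ : GL (Fin 2) (ZMod 3)) : Matrix (Fin 2) (Fin 2) (ZMod 3)) =
      M2.toMat (M2.conj x (M2.ofMat (g : Matrix (Fin 2) (Fin 2) (ZMod 3)))) := by
  rw [Units.val_mul, Units.val_mul, val_toGL, val_toGL_inv, M2.conj, M2.toMat_mul, M2.toMat_mul,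
    M2.toMat_ofMat]

/-- The transvection `T = (1 1; 0 1)` as an element of `GL₂(𝔽₃)`. [folklore] -/
noncomputable def tvGL : GL (Fin 2) (ZMod 3) := toGL M2.tv (by decide)

/-- The transvection `T′ = (1 0; 1 1)` as an element of `GL₂(𝔽₃)`. [folklore] -/
noncomputable def tv'GL : GL (Fin 2) (ZMod 3) := toGL M2.tv' (by decide)

/-- **`T` and `T′` lie in every normal subgroup containing an element of determinant `−1`**
(certificate (C1) transported). [folklore] -/
theorem tv_mem_and_tv'_mem_of_normal (H : Subgroup (GL (Fin 2) (ZMod 3))) [hH : H.Normal]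
    {g : GL (Fin 2) (ZMod 3)} (hg : g ∈ H)
    (hdet : (g : Matrix (Fin 2) (Fin 2) (ZMod 3)).det = 2) :
    tvGL ∈ H ∧ tv'GL ∈ H := by
  set x : M2 := M2.ofMat (g : Matrix (Fin 2) (Fin 2) (ZMod 3)) with hxdef
  have hxg : M2.toMat x = (g : Matrix (Fin 2) (Fin 2) (ZMod 3)) := M2.toMat_ofMat _
  have hx : M2.det x = 2 := by rw [← M2.det_toMat, hxg, hdet]
  obtain ⟨h11, h12, h21, h22, hT, hT'⟩ := M2.conj_certificate x hx
  have conj_mem : ∀ (y : M2) (hy : M2.det y ≠ 0), toGL y hy * g * (toGL y hy)⁻¹ ∈ H :=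
    fun y hy => hH.conj_mem g hg (toGL y hy)
  refine ⟨?_, ?_⟩
  · have heq : tvGL = toGL _ h11 * g * (toGL _ h11)⁻¹ * (toGL _ h12 * g * (toGL _ h12)⁻¹) := by
      apply Matrix.GeneralLinearGroup.ext
      intro i j
      rw [Units.val_mul, val_conj_toGL, val_conj_toGL, ← M2.toMat_mul, ← hxdef, hT]
      rfl
    rw [heq]; exact H.mul_mem (conj_mem _ h11) (conj_mem _ h12)
  · have heq : tv'GL = toGL _ h21 * g * (toGL _ h21)⁻¹ * (toGL _ h22 * g * (toGL _ h22)⁻¹) := by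
      apply Matrix.GeneralLinearGroup.ext
      intro i j
      rw [Units.val_mul, val_conj_toGL, val_conj_toGL, ← M2.toMat_mul, ← hxdef, hT']
      rfl
    rw [heq]; exact H.mul_mem (conj_mem _ h21) (conj_mem _ h22)

/-- Evaluation of a word in `tvGL, tv'GL` inside `GL₂(𝔽₃)`. [folklore] -/
noncomputable def evalWordGL : List Bool → GL (Fin 2) (ZMod 3)
  | [] => 1
  | b :: w => (if b then tvGL else tv'GL) * evalWordGL w

/-- The underlying matrix of `evalWordGL w` is `M2.toMat (M2.evalWord w)`. [folklore] -/
theorem val_evalWordGL (w : List Bool) :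
    ((evalWordGL w : GL (Fin 2) (ZMod 3)) : Matrix (Fin 2) (Fin 2) (ZMod 3)) =
      M2.toMat (M2.evalWord w) := by
  induction w with
  | nil => rw [evalWordGL, M2.evalWord, Units.val_one, M2.toMat_one]
  | cons b w ih =>
      rw [evalWordGL, M2.evalWord, Units.val_mul, ih, M2.toMat_mul]
      cases b
      · rfl
      · rfl

/-- A word in `tvGL, tv'GL` lies in any subgroup containing both. [folklore] -/
theorem evalWordGL_mem (H : Subgroup (GL (Fin 2) (ZMod 3))) (hT : tvGL ∈ H) (hT' : tv'GL ∈ H)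
    (w : List Bool) : evalWordGL w ∈ H := by
  induction w with
  | nil => exact H.one_mem
  | cons b w ih =>
      rw [evalWordGL]
      refine H.mul_mem ?_ ih
      cases b
      · exact hT'
      · exact hT

/-- **`SL₂(𝔽₃) = ⟨T, T′⟩`-type statement as used: `ker det ≤ H` whenever `T, T′ ∈ H`**
(certificate (C2) transported). [folklore] -/
theorem ker_det_le_of_tv_mem (H : Subgroup (GL (Fin 2) (ZMod 3))) (hT : tvGL ∈ H)
    (hT' : tv'GL ∈ H) :
    (Matrix.GeneralLinearGroup.det : GL (Fin 2) (ZMod 3) →* (ZMod 3)ˣ).ker ≤ H := by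
  intro h hh
  set x : M2 := M2.ofMat (h : Matrix (Fin 2) (Fin 2) (ZMod 3)) with hxdef
  have hxg : M2.toMat x = (h : Matrix (Fin 2) (Fin 2) (ZMod 3)) := M2.toMat_ofMat _
  have hx : M2.det x = 1 := by rw [← M2.det_toMat, hxg, (mem_ker_det_iff h).mp hh]
  have heq : h = evalWordGL (M2.wordTable x) := by
    apply Matrix.GeneralLinearGroup.ext
    intro i j
    rw [val_evalWordGL, M2.word_certificate x hx, hxg]
  rw [heq]
  exact evalWordGL_mem H hT hT' _

/-- **A normal subgroup of `GL₂(𝔽₃)` containing an element of determinant `≠ 1` is everything.**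
(`T, T′ ∈ H` by (C1), so `ker det ≤ H` by (C2); `[GL₂(𝔽₃) : ker det] = 2` forces `H.index ∣ 2`,
and `H ≠ ker det` because `g ∈ H`.) [folklore] -/
theorem eq_top_of_normal_of_det_ne_one (H : Subgroup (GL (Fin 2) (ZMod 3))) [H.Normal]
    {g : GL (Fin 2) (ZMod 3)} (hg : g ∈ H)
    (hdet : (g : Matrix (Fin 2) (Fin 2) (ZMod 3)).det ≠ 1) : H = ⊤ := by
  -- the determinant of `g` is a non-zero, non-`1` element of `𝔽₃`, i.e. `2`
  have hne0 : (g : Matrix (Fin 2) (Fin 2) (ZMod 3)).det ≠ 0 := by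
    rw [← Matrix.GeneralLinearGroup.val_det_apply]; exact (Matrix.GeneralLinearGroup.det g).ne_zero
  have h012 : ∀ d : ZMod 3, d ≠ 0 → d ≠ 1 → d = 2 := by decide
  have hdet2 : (g : Matrix (Fin 2) (Fin 2) (ZMod 3)).det = 2 := h012 _ hne0 hdet
  obtain ⟨hT, hT'⟩ := tv_mem_and_tv'_mem_of_normal H hg hdet2
  have hker : (Matrix.GeneralLinearGroup.det : GL (Fin 2) (ZMod 3) →* (ZMod 3)ˣ).ker ≤ H :=
    ker_det_le_of_tv_mem H hT hT'
  have hdvd : H.index ∣ 2 := by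
    have h := Subgroup.index_dvd_of_le hker
    rwa [index_ker_det] at h
  rcases (Nat.dvd_prime Nat.prime_two).mp hdvd with h1 | h2
  · exact Subgroup.index_eq_one.mp h1
  · exfalso
    have hH : H = (Matrix.GeneralLinearGroup.det : GL (Fin 2) (ZMod 3) →* (ZMod 3)ˣ).ker :=
      eq_ker_det_of_index_two H h2
    rw [hH, mem_ker_det_iff] at hg
    exact hdet hg

/-- **Every proper normal subgroup of `GL₂(𝔽₃)` lies in `SL₂(𝔽₃) = ker det`** — the `𝔽₃`
substitute for Artin's theorem (MEMO-v2 Lemma B (B4)). [folklore] -/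
theorem le_ker_det_of_normal_of_ne_top (H : Subgroup (GL (Fin 2) (ZMod 3))) [H.Normal]
    (hH : H ≠ ⊤) :
    H ≤ (Matrix.GeneralLinearGroup.det : GL (Fin 2) (ZMod 3) →* (ZMod 3)ˣ).ker := by
  intro g hg
  rw [mem_ker_det_iff]
  by_contra hdet
  exact hH (eq_top_of_normal_of_det_ne_one H hg hdet)

end GL2F3

end Summit.BirchSwinnertonDyer.Rank1Residual.X11b.Three
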